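import Literature.AlgebraicGeometry.AbelianSchemes.TorsionSectionPairingDualIsogeny
import Literature.AlgebraicGeometry.AbelianSchemes.AbelianSchemeDualPairSlice
import Literature.AlgebraicGeometry.AbelianSchemes.AbelianSchemeFibreHom
import Literature.AlgebraicGeometry.AbelianSchemes.IsLambdaOfAtMulAdd
import Literature.AlgebraicGeometry.AbelianVarieties.AbelianVarietyWeilDivisorBundleDictionary
import Literature.AlgebraicGeometry.Motives.AlgPointsSeparate
import HarnessLib

/-!
# The Rosati identity `e′ ≫ λ = λ ≫ e^∨` AT A GEOMETRIC POINT from the Weil-divisor identity `D^Θ_{e′P} ∼ e^*D^Θ_P`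
# ([Mumford AV] §20 property (3) and §23; [MFK94] Def. 6.2–6.3; [Milne AV] I §8)

Layer `Literature/AlgebraicGeometry/AbelianSchemes`, namespace `Literature.AlgebraicGeometry.AbelianSchemes.AbelianSchemeOver`.
THEOREMS ONLY (no definition, no named fact, no instance, no `sorry`).  Cell `hodgecm-mathlib` (D-0151), P6 «MOD programme», crux
hLiu418 (`stmt-HodgeConjecture-24832`, `--supports`, count-neutral), E-line `Cruxes/HLiu418/Lines/F0_P6a_PELWitnessE.lean`, organ
**E6-R** step (R2) (LEAD F0P6-plan (g2) 2026-09-01T22:33:07Z; A-p04 (g23) CENSUS-E6R 28f566deafbc73d3): the SCHEME HALF of the Rosati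
identity at one field-valued point — the point socket of ★ B-α `AbelianSchemeOver.rosati_of_forall_exists_fieldPoint`
(`RingActionOfPointwiseIdentities`).  HC_CM is proved only modulo the 2 remaining named inputs (hLiu418 24832, h413 24833) until rung 0
closes; nothing here is about HC.

THE MATHEMATICS.  Let `A/S` be an abelian scheme with a dual pair `(Â, 𝒫)` (★ `DualPair`), `λ : A → Â` an `S`-homomorphism which at
the geometric point `s : Spec Ω → S` is `Λ(𝒪(Θ))` for a Cartier divisor `Θ` on the fibre `A_s` (★ `IsLambdaOfAt`: the slice
`𝒫|_{A_s × {λ̄(P)}}` is `t_P^*𝒪(Θ) ⊗ 𝒪(Θ)⁻¹`, [MumfordFogartyKirwan1994] Def. 6.2), and `e, e′ : A → A` endomorphisms.  The value of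
`e′ ≫ λ` at an `Ω`-point `P` of `A_s` is `λ̄(e′_s P)`, whose slice is `t_{e′P}^*𝒪(Θ) ⊗ 𝒪(Θ)⁻¹ = 𝒪(D^Θ_{e′P})`; the value of
`λ ≫ e^∨` at `P` is `λ̄(P) ≫ e^∨`, whose slice is `e_s^*(t_P^*𝒪(Θ) ⊗ 𝒪(Θ)⁻¹) = 𝒪(e_s^*D^Θ_P)` — the defining property of the dual
homomorphism `e^∨` ([MumfordAV1970] §15 Thm. 1, [MilneAV2008] I §8–§9: `e^∨` classifies `(e × 1)^*𝒫`; ★ `DualPair.nonempty_pullbackP_comp_dualIsogenyOver_iso`,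
[MumfordAV1970] §20 property (3) «`e_n(f(x), ŷ) = e_n(x, f̂(ŷ))`»).  Hence, IF `D^Θ_{e′P} ∼ e_s^*D^Θ_P` for every `Ω`-point `P` of `A_s`
(the hypothesis — supplied over `ℂ` by ★ `HodgeTheory.weilDiv_map_linEquiv_pullback_weilDiv_of_form_adjoint` for endomorphisms ADJOINT for the
Néron–Severi form of `Θ`, [Lange2023] Prop. 2.4.2 (a)), the two values have isomorphic slices ([GortzWedhorn2020] Prop. 11.21 + [Hartshorne1977]
III Ex. 4.5: ★ `detClass_translateTensorDual_eq_cechClass_weilDiv`, `nonempty_iso_iff_detClass_eq`), hence coincide as points of `Â` («`b ↦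
[𝒫|_{A×{b}}]` is injective», ★ `DualPair.eq_of_nonempty_iso`); and `Ω`-points separate morphisms from the reduced fibre `A_s` ([MumfordAV1970] §4, ★
`Motives.SchemeOver.hom_ext_of_forall_algPoints`), so `(e′ ≫ λ) ×_S s = (λ ≫ e^∨) ×_S s`.

* §1 `nonempty_pullbackP_valueAt_comp_dualIsogeny_iso` — the slice at `λ̄(P) ≫ e^∨` is `e_s^*(t_P^*𝒪(Θ) ⊗ 𝒪(Θ)⁻¹)`;
* §2 `nonempty_pullback_translateTensorDual_iso_of_weilDiv_linEquiv` — `e_s^*(t_P^*𝒪(Θ) ⊗ 𝒪(Θ)⁻¹) ≅ t_{e′P}^*𝒪(Θ) ⊗ 𝒪(Θ)⁻¹` from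
  `D^Θ_{e′P} ∼ e_s^*D^Θ_P`;
* §3 `valueAt_map_fibreHom_eq_valueAt_comp_dualIsogeny` — `λ̄(e′_s P) = λ̄(P) ≫ e^∨` as points of `Â`;
* §4 **`pullback_map_comp_eq_pullback_map_comp_dualIsogenyOver_of_forall_weilDiv_linEquiv`** — THE HEAD:
  `(Over.pullback s).map (e′ ≫ λ) = (Over.pullback s).map (λ ≫ e^∨)` (★ B-α's point socket, verbatim shape).

## References
* [MumfordAV1970] D. Mumford, *Abelian Varieties* (1970), §4, §15 Thm. 1 (p. 143), §20 p. 186 property (3), §23 p. 208.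
* [MumfordFogartyKirwan1994] D. Mumford, J. Fogarty, F. Kirwan, *Geometric Invariant Theory*, Ch. 6 §2 Def. 6.2–6.3 (p. 120).
* [MilneAV2008] J. S. Milne, *Abelian Varieties* (2008), I §8 pp. 36–37, I §9 Thm. 9.1 (p. 42).
* [GortzWedhorn2020] U. Görtz, T. Wedhorn, *Algebraic Geometry I*, Prop. 11.21 (p. 374).  [Hartshorne1977] III Ex. 4.5.
-/

set_option autoImplicit false

noncomputable section

universe u

open CategoryTheory CategoryTheory.Limits AlgebraicGeometry MonoidalCategory
open scoped MonObj

namespace Literature.AlgebraicGeometry.AbelianSchemes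

namespace AbelianSchemeOver

open Literature.AlgebraicGeometry.Motives Literature.AlgebraicGeometry.AbelianVarieties Literature.AlgebraicGeometry.Modules

variable {S : Scheme.{u}} {A : AbelianSchemeOver S} (D : A.DualPair) (lam : A.X ⟶ D.hat.X)
  {Ω : Type u} [Field Ω] (s : Spec (.of Ω) ⟶ S)

/-! ### §0 Plumbing: the base change of an `S`-morphism over the first projection -/

/-- `(f ×_S s) ≫ pr_B = pr_A ≫ f` for the base change `(Over.pullback s).map f : A ×_S Spec Ω → B ×_S Spec Ω` of an `S`-morphism `f : A → B`.
[cite: GortzWedhorn2020, Section (4.7) (p. 135)] -/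
theorem pullback_map_left_comp_fst {X Y : Over S} (f : X ⟶ Y) :
    ((Over.pullback s).map f).left ≫ pullback.fst Y.hom s = pullback.fst X.hom s ≫ f.left :=
  (congrArg (fun x => x ≫ pullback.fst Y.hom s) (Over.pullback_map_left s X (k := f))).trans (pullback.lift_fst _ _ _)

/-- The point of `B` under `P ≫ (f ×_S s)` for an `Ω`-point `P` of the fibre `A_s` is `(pr_A ∘ P) ≫ f`.
[cite: MumfordFogartyKirwan1994, Ch. 6 §2 Definition 6.3 (p. 120)] -/
theorem left_comp_pullback_map_comp_fst {Y : Over S} (f : A.X ⟶ Y) (P : (A.fibre s).toAbelianVariety.Points Ω) :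
    (P ≫ (Over.pullback s).map f).left ≫ pullback.fst Y.hom s = A.fibrePointToLeft s P ≫ f.left := by
  -- `(P ≫ g).left = P.left ≫ g.left` definitionally; reassociate around `pullback_map_left_comp_fst`
  have h := pullback_map_left_comp_fst s f
  exact (Category.assoc _ _ _).trans
    ((congrArg (fun x => (P.left : Spec (.of Ω) ⟶ pullback A.X.hom s) ≫ x) h).trans (Category.assoc _ _ _).symm)

/-! ### §1 The slice at `λ̄(P) ≫ e^∨` is `e_s^*(t_P^*𝒪(Θ) ⊗ 𝒪(Θ)⁻¹)` -/

/-- **The 𝒫-slice at the point `λ̄(P) ≫ e^∨` of `Â` is `e_s^*(t_P^*𝒪(Θ) ⊗ 𝒪(Θ)⁻¹)`** ([MumfordAV1970] §15 Thm. 1 / [MilneAV2008] I §8–§9: `e^∨`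
classifies `(e × 1)^*𝒫`, so `𝒫|_{A_s × {c ≫ e^∨}} ≅ e_s^*(𝒫|_{A_s × {c}})` — ★ `DualPair.nonempty_pullbackP_comp_dualIsogenyOver_iso` at the
`Spec Ω`-point `c = λ̄(P)` — and `𝒫|_{A_s × {λ̄(P)}} ≅ t_P^*𝒪(Θ) ⊗ 𝒪(Θ)⁻¹` by ★ `IsLambdaOfAt`).
[cite: MumfordAV1970, §15 Thm. 1 (p. 143) and §20 property (3) (p. 186)] [cite: MilneAV2008, I §8 pp. 36–37] -/
theorem nonempty_pullbackP_valueAt_comp_dualIsogeny_iso {Θ : CartierDivisor (A.fibre s).toAbelianVariety.X.left}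
    (hΘ : A.IsLambdaOfAt s D lam Θ) (e : A.X ⟶ A.X) [IsMonHom e] (P : (A.fibre s).toAbelianVariety.Points Ω) :
    Nonempty (D.pullbackP s (A.valueAt s D lam P ≫ DualPair.dualIsogeny e D D)
        (by rw [Category.assoc, DualPair.dualIsogeny_comp_hom, valueAt_comp_hom]) ≅
      (Scheme.Modules.pullback (AbelianVariety.Hom.toSchemeHom (fibreHom e s))).obj
        (tensorObj
          ((Scheme.Modules.pullback ((A.fibre s).toAbelianVariety.translation P).left).obj (A.lineBundleOfDivisor s Θ))
          (Modules.dual (A.lineBundleOfDivisor s Θ)))) := by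
  -- the point `λ̄(P)` as a morphism of `S`-schemes `Spec Ω → Â`
  let c : Over.mk s ⟶ D.hat.X := Over.homMk (A.valueAt s D lam P) (A.valueAt_comp_hom s D lam P)
  obtain ⟨i₁⟩ := DualPair.nonempty_pullbackP_comp_dualIsogenyOver_iso e D D s c
  obtain ⟨i₂⟩ := AbelianSchemeOver.IsLambdaOfAt.nonempty_iso A s D lam hΘ P
  -- `pullbackP s c.left _` is `𝒫` pulled back along the [MFK] slice at `λ̄(P)` (definitionally)
  have h₂ : Nonempty (D.pullbackP s c.left (Over.w c) ≅
      tensorObj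
        ((Scheme.Modules.pullback ((A.fibre s).toAbelianVariety.translation P).left).obj (A.lineBundleOfDivisor s Θ))
        (Modules.dual (A.lineBundleOfDivisor s Θ))) := ⟨i₂⟩
  obtain ⟨i₂'⟩ := h₂
  -- `(baseChangeHom e s).left` is the scheme map underlying `e_s` (definitionally)
  exact ⟨i₁ ≪≫ (Scheme.Modules.pullback (AbelianVariety.Hom.toSchemeHom (fibreHom e s))).mapIso i₂'⟩

/-! ### §2 `e_s^*(t_P^*𝒪(Θ) ⊗ 𝒪(Θ)⁻¹) ≅ t_{e′P}^*𝒪(Θ) ⊗ 𝒪(Θ)⁻¹` from `D^Θ_{e′P} ∼ e_s^*D^Θ_P` -/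

/-- **`e_s^*(t_P^*𝒪(Θ) ⊗ 𝒪(Θ)⁻¹) ≅ t_{Q}^*𝒪(Θ) ⊗ 𝒪(Θ)⁻¹` whenever `D^Θ_Q ∼ e_s^*D^Θ_P`** (rank-one modules on the integral fibre `A_s` are
isomorphic iff their classes in `Ȟ¹(A_s, 𝒪^×)` agree, [Hartshorne1977] III Ex. 4.5 ∕ ★ `nonempty_iso_iff_detClass_eq`; the classes are `[𝒪(e_s^*D^Θ_P)]`
and `[𝒪(D^Θ_Q)]` by ★ `detClass_translateTensorDual_eq_cechClass_weilDiv`, ★ `detClass_pullback`, ★ `CartierDivisor.cechClass_pullback`, and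
`D ↦ [𝒪(D)]` is injective on classes, [GortzWedhorn2020] Prop. 11.21 ∕ ★ `cechClass_eq_iff_linEquiv`).
[cite: GortzWedhorn2020, Prop. 11.21 (p. 374) and Def. 11.49 (p. 392)] [cite: Hartshorne1977, III Ex. 4.5] -/
theorem nonempty_pullback_translateTensorDual_iso_of_weilDiv_linEquiv (Θ : CartierDivisor (A.fibre s).toAbelianVariety.X.left)
    (e : A.X ⟶ A.X) [IsMonHom e] [IsDominant (AbelianVariety.Hom.toSchemeHom (fibreHom e s))]
    (P Q : (A.fibre s).toAbelianVariety.Points Ω)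
    (h : ((A.fibre s).toAbelianVariety.weilDiv Θ Q).LinEquiv
      (((A.fibre s).toAbelianVariety.weilDiv Θ P).pullback (AbelianVariety.Hom.toSchemeHom (fibreHom e s)))) :
    Nonempty ((Scheme.Modules.pullback (AbelianVariety.Hom.toSchemeHom (fibreHom e s))).obj
        (tensorObj
          ((Scheme.Modules.pullback ((A.fibre s).toAbelianVariety.translation P).left).obj (A.lineBundleOfDivisor s Θ))
          (Modules.dual (A.lineBundleOfDivisor s Θ))) ≅
      tensorObj
        ((Scheme.Modules.pullback ((A.fibre s).toAbelianVariety.translation Q).left).obj (A.lineBundleOfDivisor s Θ))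
        (Modules.dual (A.lineBundleOfDivisor s Θ))) := by
  have hP := hasRank_translateTensorDual (A := A) s Θ P
  have hQ := hasRank_translateTensorDual (A := A) s Θ Q
  have hP' : IsFiniteLocallyFree (tensorObj
      ((Scheme.Modules.pullback ((A.fibre s).toAbelianVariety.translation P).left).obj (A.lineBundleOfDivisor s Θ))
      (Modules.dual (A.lineBundleOfDivisor s Θ))) := HasRank.isFiniteLocallyFree' hP
  have hQ' : IsFiniteLocallyFree (tensorObj
      ((Scheme.Modules.pullback ((A.fibre s).toAbelianVariety.translation Q).left).obj (A.lineBundleOfDivisor s Θ))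
      (Modules.dual (A.lineBundleOfDivisor s Θ))) := HasRank.isFiniteLocallyFree' hQ
  rw [nonempty_iso_iff_detClass_eq (hasRank_pullback _ hP) hQ (hP'.pullback (AbelianVariety.Hom.toSchemeHom (fibreHom e s))) hQ',
    detClass_pullback (AbelianVariety.Hom.toSchemeHom (fibreHom e s)) hP',
    detClass_translateTensorDual_eq_cechClass_weilDiv _ Θ P hP', detClass_translateTensorDual_eq_cechClass_weilDiv _ Θ Q hQ',
    ← CartierDivisor.cechClass_pullback, CartierDivisor.cechClass_eq_iff_linEquiv]
  exact h.symm

/-! ### §3 `λ̄(e′_s P) = λ̄(P) ≫ e^∨` as points of `Â` -/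

/-- **`λ̄(e′_s P) = λ̄(P) ≫ e^∨`** — the value of `e′ ≫ λ` and of `λ ≫ e^∨` at the `Ω`-point `P` of `A_s` coincide as points `Spec Ω → Â`, as
soon as `D^Θ_{e′P} ∼ e_s^*D^Θ_P`: both slices of `𝒫` are `t_{e′P}^*𝒪(Θ) ⊗ 𝒪(Θ)⁻¹` (§1, §2, ★ `IsLambdaOfAt`), and a point of `Â` is determined by its
slice ([MilneAV2008] I §8 uniqueness, ★ `DualPair.eq_of_nonempty_iso`).  This is [MumfordAV1970] §20 property (3) / §23 `φ_L(γ′ x) = γ̂(φ_L(x))` for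
the Rosati dual `γ′`, read pointwise. [cite: MumfordAV1970, §20 property (3) p. 186 and §23 p. 208] [cite: MilneAV2008, I §8 pp. 36–37]
[cite: MumfordFogartyKirwan1994, Ch. 6 §2 Definition 6.2–6.3 (p. 120)] -/
theorem valueAt_map_fibreHom_eq_valueAt_comp_dualIsogeny {Θ : CartierDivisor (A.fibre s).toAbelianVariety.X.left}
    (hΘ : A.IsLambdaOfAt s D lam Θ) (e e' : A.X ⟶ A.X) [IsMonHom e] [IsMonHom e']
    [IsDominant (AbelianVariety.Hom.toSchemeHom (fibreHom e s))] (P : (A.fibre s).toAbelianVariety.Points Ω)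
    (h : ((A.fibre s).toAbelianVariety.weilDiv Θ (AlgPoints.map (fibreHom e' s).hom.hom.hom P)).LinEquiv
      (((A.fibre s).toAbelianVariety.weilDiv Θ P).pullback (AbelianVariety.Hom.toSchemeHom (fibreHom e s)))) :
    A.valueAt s D lam (AlgPoints.map (fibreHom e' s).hom.hom.hom P) = A.valueAt s D lam P ≫ DualPair.dualIsogeny e D D := by
  set Q := AlgPoints.map (fibreHom e' s).hom.hom.hom P with hQ
  -- test bundle: the slice at `λ̄(Q)`; both points pull `𝒫` back to it
  obtain ⟨i₁⟩ := nonempty_pullbackP_valueAt_comp_dualIsogeny_iso D lam s hΘ e P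
  obtain ⟨i₂⟩ := nonempty_pullback_translateTensorDual_iso_of_weilDiv_linEquiv (A := A) s Θ e P Q h
  obtain ⟨i₃⟩ := AbelianSchemeOver.IsLambdaOfAt.nonempty_iso A s D lam hΘ Q
  have h₃ : Nonempty (D.pullbackP s (A.valueAt s D lam Q) (A.valueAt_comp_hom s D lam Q) ≅
      (D.sliceBundle (A.valueAt s D lam Q) s (A.valueAt_comp_hom s D lam Q)).L) := ⟨Iso.refl _⟩
  have h₃' : Nonempty ((D.sliceBundle (A.valueAt s D lam Q) s (A.valueAt_comp_hom s D lam Q)).L ≅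
      tensorObj
        ((Scheme.Modules.pullback ((A.fibre s).toAbelianVariety.translation Q).left).obj (A.lineBundleOfDivisor s Θ))
        (Modules.dual (A.lineBundleOfDivisor s Θ))) := ⟨i₃⟩
  obtain ⟨i₃'⟩ := h₃'
  exact D.eq_of_nonempty_iso s (D.sliceBundle (A.valueAt s D lam Q) s (A.valueAt_comp_hom s D lam Q))
    (D.sliceBundle_fibrewisePicZero _ s _) _ _ (A.valueAt_comp_hom s D lam Q)
    (by rw [Category.assoc, DualPair.dualIsogeny_comp_hom, valueAt_comp_hom]) h₃ ⟨i₁ ≪≫ i₂ ≪≫ i₃'.symm⟩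

/-! ### §4 THE HEAD: the Rosati identity after base change to the point -/

/-- **ROSATI AT A GEOMETRIC POINT from the Weil-divisor identity** — the point socket of ★ B-α `rosati_of_forall_exists_fieldPoint`
(`RingActionOfPointwiseIdentities`, [Kottwitz1992] §5): for an abelian scheme `A/S` with dual pair `(Â, 𝒫)`, an `S`-homomorphism `λ : A → Â` which is
`Λ(𝒪(Θ))` at the algebraically-closed-field-valued point `s` (★ `IsLambdaOfAt`), and endomorphisms `e, e′` of `A` (`e_s` dominant) such that
`D^Θ_{e′_s P} ∼ e_s^*D^Θ_P` for every `Ω`-point `P` of the fibre `A_s` (over `ℂ`: ★ `HodgeTheory.weilDiv_map_linEquiv_pullback_weilDiv_of_form_adjoint`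
for endomorphisms adjoint for the Néron–Severi form of `Θ`), the base changes to `s` of `e′ ≫ λ` and `λ ≫ e^∨` COINCIDE:
`(Over.pullback s).map (e′ ≫ λ) = (Over.pullback s).map (λ ≫ e^∨)`.  Proof: §3 at every `Ω`-point + `Ω`-points separate morphisms from the
reduced finite-type `A_s` to the separated `Â_s` ([MumfordAV1970] §4, ★ `Motives.SchemeOver.hom_ext_of_forall_algPoints`).
[cite: MumfordAV1970, §4, §20 property (3) p. 186, §23 p. 208] [cite: MumfordFogartyKirwan1994, Ch. 6 §2 Definition 6.2–6.3 (p. 120)]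
[cite: Kottwitz1992, §5 (p. 390)] -/
theorem pullback_map_comp_eq_pullback_map_comp_dualIsogenyOver_of_forall_weilDiv_linEquiv [IsAlgClosed Ω]
    {Θ : CartierDivisor (A.fibre s).toAbelianVariety.X.left} (hΘ : A.IsLambdaOfAt s D lam Θ)
    (e e' : A.X ⟶ A.X) [IsMonHom e] [IsMonHom e'] [IsDominant (AbelianVariety.Hom.toSchemeHom (fibreHom e s))]
    (h : ∀ P : (A.fibre s).toAbelianVariety.Points Ω,
      ((A.fibre s).toAbelianVariety.weilDiv Θ (AlgPoints.map (fibreHom e' s).hom.hom.hom P)).LinEquiv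
        (((A.fibre s).toAbelianVariety.weilDiv Θ P).pullback (AbelianVariety.Hom.toSchemeHom (fibreHom e s)))) :
    (Over.pullback s).map (e' ≫ lam) = (Over.pullback s).map (lam ≫ DualPair.dualIsogenyOver e D D) := by
  haveI := (A.fibre s).toAbelianVariety.isProper
  haveI := (D.hat.fibre s).toAbelianVariety.isProper
  -- `Ω`-points separate morphisms `A_s → Â_s` over `Spec Ω`
  refine Motives.SchemeOver.hom_ext_of_forall_algPoints (X := (A.fibre s).toAbelianVariety.X)
    (Y := (D.hat.fibre s).toAbelianVariety.X) Ω fun P => ?_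
  -- a point of `Â_s` is determined by its point of `Â` and its structure map
  apply Over.OverMorphism.ext
  apply pullback.hom_ext
  · -- the points of `Â`: `λ̄(e′_s P)` versus `λ̄(P) ≫ e^∨`
    have h1 := left_comp_pullback_map_comp_fst (A := A) s (e' ≫ lam) P
    have h2 := left_comp_pullback_map_comp_fst (A := A) s (lam ≫ DualPair.dualIsogenyOver e D D) P
    refine h1.trans (Eq.trans ?_ h2.symm)
    rw [Over.comp_left, Over.comp_left]
    calc A.fibrePointToLeft s P ≫ e'.left ≫ lam.left
        = (A.fibrePointToLeft s P ≫ e'.left) ≫ lam.left := (Category.assoc _ _ _).symm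
      _ = A.fibrePointToLeft s (AlgPoints.map (fibreHom e' s).hom.hom.hom P) ≫ lam.left := by
          rw [fibrePointToLeft_map_fibreHom]
      _ = A.valueAt s D lam (AlgPoints.map (fibreHom e' s).hom.hom.hom P) := rfl
      _ = A.valueAt s D lam P ≫ DualPair.dualIsogeny e D D :=
          valueAt_map_fibreHom_eq_valueAt_comp_dualIsogeny D lam s hΘ e e' P (h P)
      _ = A.fibrePointToLeft s P ≫ lam.left ≫ (DualPair.dualIsogenyOver e D D).left := by
          rw [valueAt, Category.assoc, DualPair.dualIsogenyOver_left]
  · -- both lie over `Spec Ω`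
    exact (Over.w (P ≫ (Over.pullback s).map (e' ≫ lam))).trans
      (Over.w (P ≫ (Over.pullback s).map (lam ≫ DualPair.dualIsogenyOver e D D))).symm

end AbelianSchemeOver

end Literature.AlgebraicGeometry.AbelianSchemes

end
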